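import Literature.Algebra.Homology.HopfTraceFormulaBaseChange
import Mathlib.Algebra.Category.ModuleCat.Descent
import HarnessLib

/-!
# Homology commutes with flat base change: traces and the Lefschetz number across `R → K`

Layer `Literature/Algebra/Homology` (pure algebra over Mathlib; proved theorems only, 0 definitions, 0 named facts, no instances, no notation).
Row `HopfTraceFormulaBaseChange` reads the CHAIN-level super-trace of an endomorphism `φ` of a complex of free `R`-modules in a field `K`
along `f : R →+* K` (`f(Σᶠ χ(i)•tr_R φᵢ) = Λ(K ⊗_R φ)`). This file adds the HOMOLOGY side when `f` is FLAT (Mathlib `RingHom.Flat`):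
`K ⊗_R −` is then exact (Mathlib `ModuleCat.preservesFiniteLimits_extendScalars_of_flat` + the adjunction
`ModuleCat.extendRestrictScalarsAdj`), hence preserves homology (`ShortComplex.preservesHomologyOfExact`), and Mathlib's comparison
`ShortComplex.mapHomologyIso` `Hₙ(K ⊗_R C) ≅ K ⊗_R Hₙ(C)` — CONSUMED here, never named — is natural in `φ`. For `Hₙ(C)` finitely
generated and free:

* `finrank_homology_extendScalars` — `dim_K Hₙ(K ⊗_R C) = rank_R Hₙ(C)`; `moduleFinite_homology_extendScalars`;
* **`trace_homologyMap_extendScalars : tr_K(Hₙ(K ⊗_R φ)) = f(tr_R Hₙ(φ))`**;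
* **`lefschetzNumber_extendScalars : Λ(K ⊗_R φ) = f(Σᶠ χ(n) • tr_R Hₙ(φ))`**, and with row `HopfTraceFormulaBaseChange`:
  **`finsum_χ_smul_trace_f_eq_of_injective`** — for `f` flat and injective (e.g. a domain into its fraction field) and free terms and
  homology, the Hopf trace formula holds over `R` itself: `Σᶠ χ(i) • tr_R(φᵢ) = Σᶠ χ(i) • tr_R(Hᵢ(φ))`;
* `Int.castRingHom_rat_flat` and `finsum_χ_smul_trace_f_eq_int` — the case `ℤ → ℚ`: Hatcher's Thm. 2C.3 over `ℤ` for
  complexes of finitely generated free abelian groups whose homology is free (the torsion-free case; traces on `Hₙ ∕ torsion` in general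
  are NOT treated here).

Universe-monomorphic (`R K : Type u`, modules in `ModuleCat.{u}`), as Mathlib's flatness packaging is. The binder
`[(ModuleCat.extendScalars f).Additive]` is a hypothesis as in row `HopfTraceFormulaBaseChange` (dischargeable by the tree's
`Literature.Algebra.Homology.additive_extendScalars`). Library only (cell `pub-hodge-ring2`, count-neutral); proves nothing about any crux,
route or conjecture.

## References

* A. Hatcher, *Algebraic Topology* (2002), §2.C, Thm. 2C.3. [HatcherAT2002]
* E. H. Spanier, *Algebraic Topology* (1981), Ch. 4 §7, Thm. 6; Ch. 5 §2 (universal coefficients). [Spanier1981]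
-/

open CategoryTheory CategoryTheory.Limits

universe u w

namespace Literature.Algebra.Homology.HopfTrace

variable {R K : Type u} [CommRing R] [Field K] (f : R →+* K) [(ModuleCat.extendScalars.{u, u, u} f).Additive]
  {ι : Type w} {c : ComplexShape ι} (C : HomologicalComplex (ModuleCat.{u} R) c) (φ : C ⟶ C)

/-- Where `Cₙ = 0`, so is `Hₙ(C)` (any ring; a subquotient). [cite: HatcherAT2002, §2.C] -/
theorem subsingleton_homology_of_subsingleton_X {S : Type u} [Ring S] (D : HomologicalComplex (ModuleCat.{u} S) c) (n : ι)
    [Subsingleton (D.X n)] : Subsingleton (D.homology n) := by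
  haveI : Subsingleton (D.sc n).X₂ := ‹Subsingleton (D.X n)›
  haveI : Subsingleton ((D.sc n).moduleCatLeftHomologyData.H) :=
    (Submodule.mkQ_surjective (LinearMap.range (D.sc n).moduleCatToCycles)).subsingleton
  exact (D.sc n).moduleCatHomologyIso.toLinearEquiv.toEquiv.subsingleton

/-- For flat `f`, `K ⊗_R −` preserves homology (exactness: Mathlib's flatness packaging + the extension∕restriction adjunction).
[cite: HatcherAT2002, §2.C] -/
theorem preservesHomology_extendScalars (hf : f.Flat) : (ModuleCat.extendScalars.{u, u, u} f).PreservesHomology := by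
  haveI : PreservesFiniteLimits (ModuleCat.extendScalars.{u, u, u} f) := ModuleCat.preservesFiniteLimits_extendScalars_of_flat hf
  haveI : PreservesColimitsOfSize.{u, u} (ModuleCat.extendScalars.{u, u, u} f) :=
    (ModuleCat.extendRestrictScalarsAdj f).leftAdjoint_preservesColimits
  infer_instance

/-- **`Hₙ(K ⊗_R φ)` is conjugate to `K ⊗_R Hₙ(φ)`** along Mathlib's comparison isomorphism (flat `f`): there is a `K`-linear
equivalence `e : Hₙ(K ⊗_R C) ≃ K ⊗_R Hₙ(C)` with `e ∘ Hₙ(K ⊗_R φ) = (K ⊗_R Hₙ(φ)) ∘ e`. [cite: HatcherAT2002, §2.C] -/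
theorem exists_conj_homologyMap_extendScalars (hf : f.Flat) (n : ι) :
    ∃ e : (((ModuleCat.extendScalars f).mapHomologicalComplex c).obj C).homology n ≃ₗ[K]
        (ModuleCat.extendScalars f).obj (C.homology n),
      e.toLinearMap ∘ₗ (HomologicalComplex.homologyMap (((ModuleCat.extendScalars f).mapHomologicalComplex c).map φ) n).hom =
        ((ModuleCat.extendScalars f).map (HomologicalComplex.homologyMap φ n)).hom ∘ₗ e.toLinearMap := by
  haveI := preservesHomology_extendScalars f hf
  let e : (((ModuleCat.extendScalars f).mapHomologicalComplex c).obj C).homology n ≅ (ModuleCat.extendScalars f).obj (C.homology n) :=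
    ShortComplex.mapHomologyIso (C.sc n) (ModuleCat.extendScalars f)
  have h : HomologicalComplex.homologyMap (((ModuleCat.extendScalars f).mapHomologicalComplex c).map φ) n ≫ e.hom =
      e.hom ≫ (ModuleCat.extendScalars f).map (HomologicalComplex.homologyMap φ n) :=
    ShortComplex.mapHomologyIso_hom_naturality ((HomologicalComplex.shortComplexFunctor _ c n).map φ) (ModuleCat.extendScalars f)
  refine ⟨e.toLinearEquiv, ?_⟩
  have h' := congrArg ModuleCat.Hom.hom h
  simp only [ModuleCat.hom_comp] at h'
  exact h'

/-- `Hₙ(K ⊗_R C)` is finite-dimensional when `Hₙ(C)` is finitely generated (flat `f`). [cite: HatcherAT2002, §2.C] -/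
theorem moduleFinite_homology_extendScalars (hf : f.Flat) (n : ι) [Module.Finite R (C.homology n)] :
    Module.Finite K ((((ModuleCat.extendScalars f).mapHomologicalComplex c).obj C).homology n) := by
  obtain ⟨e, -⟩ := exists_conj_homologyMap_extendScalars f C (𝟙 C) hf n
  haveI := moduleFinite_extendScalars_obj f (C.homology n)
  exact Module.Finite.equiv e.symm

/-- **`dim_K Hₙ(K ⊗_R C) = rank_R Hₙ(C)`** for `Hₙ(C)` finitely generated free (flat `f`). [cite: HatcherAT2002, §2.C] -/
theorem finrank_homology_extendScalars (hf : f.Flat) (n : ι) [Module.Free R (C.homology n)] [Module.Finite R (C.homology n)] :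
    Module.finrank K ((((ModuleCat.extendScalars f).mapHomologicalComplex c).obj C).homology n) = Module.finrank R (C.homology n) := by
  obtain ⟨e, -⟩ := exists_conj_homologyMap_extendScalars f C (𝟙 C) hf n
  rw [e.finrank_eq, finrank_extendScalars_obj]

/-- **`tr_K(Hₙ(K ⊗_R φ)) = f(tr_R Hₙ(φ))`** for `Hₙ(C)` finitely generated free and `f` flat. [cite: HatcherAT2002, Thm. 2C.3] -/
theorem trace_homologyMap_extendScalars (hf : f.Flat) (n : ι) [Module.Free R (C.homology n)] [Module.Finite R (C.homology n)] :
    LinearMap.trace K _ (HomologicalComplex.homologyMap (((ModuleCat.extendScalars f).mapHomologicalComplex c).map φ) n).hom =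
      f (LinearMap.trace R _ (HomologicalComplex.homologyMap φ n).hom) := by
  obtain ⟨e, he⟩ := exists_conj_homologyMap_extendScalars f C φ hf n
  have h : (HomologicalComplex.homologyMap (((ModuleCat.extendScalars f).mapHomologicalComplex c).map φ) n).hom =
      e.symm.conj ((ModuleCat.extendScalars f).map (HomologicalComplex.homologyMap φ n)).hom := by
    rw [LinearEquiv.conj_apply, LinearEquiv.symm_symm, LinearMap.comp_assoc, ← he, ← LinearMap.comp_assoc, LinearEquiv.symm_comp,
      LinearMap.id_comp]
  rw [h, LinearMap.trace_conj', trace_extendScalars_map]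

/-- **`Λ(K ⊗_R φ) = f(Σᶠ χ(n) • tr_R Hₙ(φ))`**: the Lefschetz number of the base change is read on the `R`-homology when the latter is
finitely generated free in every degree with finitely many non-zero ranks (flat `f`). [cite: HatcherAT2002, Thm. 2C.3] -/
theorem lefschetzNumber_extendScalars (hf : f.Flat) [c.EulerCharSigns] [∀ n, Module.Free R (C.homology n)] [∀ n, Module.Finite R (C.homology n)]
    (hH : (GradedObject.finrankSupport fun n => C.homology n).Finite) :
    Lefschetz.lefschetzNumber (((ModuleCat.extendScalars f).mapHomologicalComplex c).map φ) =
      f (∑ᶠ n, (c.χ n : ℤ) • LinearMap.trace R _ (HomologicalComplex.homologyMap φ n).hom) := by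
  haveI : Nontrivial R := f.domain_nontrivial
  have hs : (fun n => (c.χ n : ℤ) • LinearMap.trace R _ (HomologicalComplex.homologyMap φ n).hom).HasFiniteSupport := by
    refine hH.subset fun n hn => ?_
    simp only [GradedObject.finrankSupport, Function.mem_support, ne_eq] at hn ⊢
    exact fun h0 => hn (by rw [trace_eq_zero_of_finrank_eq_zero (C.homology n) h0, smul_zero])
  rw [map_finsum f hs]
  exact finsum_congr fun n => by rw [map_zsmul, trace_homologyMap_extendScalars f C φ hf n]

/-- **The Hopf trace formula over `R` for free homology**: if `f : R → K` is flat and injective (e.g. a domain into its fraction field) and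
the complex has finitely generated free terms and homology, finitely many non-zero, then `Σᶠ χ(i) • tr_R(φᵢ) = Σᶠ χ(i) • tr_R(Hᵢ(φ))` in `R`
(rows `HopfTraceFormulaBaseChange` + this file, read back along `f`). [cite: HatcherAT2002, Thm. 2C.3] [cite: Spanier1981, Ch. 4 §7 Thm. 6] -/
theorem finsum_χ_smul_trace_f_eq_of_injective (hf : f.Flat) (hinj : Function.Injective f) [c.EulerCharSigns]
    [∀ i, Module.Free R (C.X i)] [∀ i, Module.Finite R (C.X i)] [∀ n, Module.Free R (C.homology n)] [∀ n, Module.Finite R (C.homology n)]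
    (hC : (GradedObject.finrankSupport C.X).Finite) (hH : (GradedObject.finrankSupport fun n => C.homology n).Finite) :
    ∑ᶠ i, (c.χ i : ℤ) • LinearMap.trace R (C.X i) (φ.f i).hom = ∑ᶠ n, (c.χ n : ℤ) • LinearMap.trace R _ (HomologicalComplex.homologyMap φ n).hom :=
  hinj ((map_finsum_χ_smul_trace_f f C φ hC).trans (lefschetzNumber_extendScalars f C φ hf hH))

end Literature.Algebra.Homology.HopfTrace

/-- `ℚ` is flat over `ℤ` (a localization), i.e. `ℤ → ℚ` is a flat ring map. [cite: HatcherAT2002, §2.C] -/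
theorem Literature.Algebra.Homology.HopfTrace.Int.castRingHom_rat_flat : (Int.castRingHom ℚ).Flat := by
  rw [show Int.castRingHom ℚ = algebraMap ℤ ℚ from rfl, RingHom.flat_algebraMap_iff]
  exact IsLocalization.flat ℚ (nonZeroDivisors ℤ)

/-- **Hatcher's Thm. 2C.3 over `ℤ`, torsion-free case**: for an endomorphism `φ` of a complex of finitely generated free abelian groups
(any shape with `EulerCharSigns`, finitely many non-zero) whose homology groups are FREE, `Σᶠ χ(i) • tr(φᵢ) = Σᶠ χ(i) • tr(Hᵢ(φ))` in `ℤ`.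
[cite: HatcherAT2002, Thm. 2C.3] -/
theorem Literature.Algebra.Homology.HopfTrace.finsum_χ_smul_trace_f_eq_int {ι : Type w} {c : ComplexShape ι} [c.EulerCharSigns]
    (C : HomologicalComplex (ModuleCat.{0} ℤ) c) (φ : C ⟶ C) [(ModuleCat.extendScalars.{0, 0, 0} (Int.castRingHom ℚ)).Additive]
    [∀ i, Module.Free ℤ (C.X i)] [∀ i, Module.Finite ℤ (C.X i)] [∀ n, Module.Free ℤ (C.homology n)] [∀ n, Module.Finite ℤ (C.homology n)]
    (hC : (GradedObject.finrankSupport C.X).Finite) (hH : (GradedObject.finrankSupport fun n => C.homology n).Finite) :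
    ∑ᶠ i, (c.χ i : ℤ) • LinearMap.trace ℤ (C.X i) (φ.f i).hom = ∑ᶠ n, (c.χ n : ℤ) • LinearMap.trace ℤ _ (HomologicalComplex.homologyMap φ n).hom :=
  Literature.Algebra.Homology.HopfTrace.finsum_χ_smul_trace_f_eq_of_injective (Int.castRingHom ℚ) C φ
    Literature.Algebra.Homology.HopfTrace.Int.castRingHom_rat_flat (Int.cast_injective (α := ℚ)) hC hH
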